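import Summits.ABC.StewartYu.PadicG3FunctionsB
import Literature.NumberTheory.Transcendental.PadicCW77Series
import HarnessLib

/-!
# Cell abc-stewartyu, crux `Y07Odd` (stmt-ABC-19658), line `gen3-slab-odd`: the class functions as POWER SERIES on the big disc —
# coefficients, convergence, the weighted bound `WtBdd (p^m √p) Bw`, and jets from values

`Summits/ABC/StewartYu/PadicG3Series.lean` — sequel to `PadicG3FunctionsB` (cell `abc-stewartyu`, seat p2-g4, F-odd lead).  Definitions and
theorems on `G3Setup`; no named fact.  Odd-`p` twin of p3-g5's `PadicG3TwoSeries.lean` with the slab radius `ρ = p^m √p` in place of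
`4` (the exponent coefficients `E(vᵢ)^j/j!` are weighted-bounded by `1` at that radius: `G3Setup.norm_pow_div_factorial_mul_le_depth`):

* `g3eC`, `g3wC`, `g3wDeg`, `coeffG3F` — the coefficient sequence of `f_τ`;
* `hasSum_coeffG3F` / `g3F_eq_tsum` / `g3F_eventuallyEq_tsum` — `f_τ(z) = Σₙ coeffG3F n zⁿ` on `‖z‖ < p^m √p`;
* **`wtBdd_coeffG3F`** — `WtBdd (p^m √p) Bw coeffG3F` from the frame's bound `‖coeffₖ(Hasse_{t₀}Rᵢ)‖·(p^m√p)ᵏ ≤ Bw`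
  (this `Bw` carries the `Y₀`-line `L₀·G` of the K-M3.1 ledgers);
* **`norm_jet_g3F_le`** — the jets of `f_τ` at a node `‖a‖ ≤ 1` are `≤ ‖(k!)⁻¹‖·ε` when the family's values there are `≤ ε`
  (the hypothesis `hjet` of `PadicNewton.norm_tsum_le_max_of_small_jets_levels`).

WHAT THIS IS NOT: the extrapolation step itself (`PadicG3KStep`); no crux moves.

References: K. Yu, Compositio 74 (1990) §1.1, Lemmas 2.2, 2.4; K. Yu, Acta Arith. 89 (1999) §10; the K-M3.1 ledgers of the cell.
-/

noncomputable section

open NormedSpace Finset IsUltrametricDist Polynomial Metric Filter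
open Literature.NumberTheory.Transcendental
open Literature.NumberTheory.Transcendental.CW77.Setup (Tau tauNorm)
open scoped Nat Topology

namespace Summit.ABC.StewartYu

namespace G3Setup

variable {p : ℕ} [Fact p.Prime] (S : G3Setup p) {ι : Type*} (R : ι → ℚ[X]) (v : ι → Fin S.n → ℤ)

/-! ### The coefficients -/

/-- The coefficients of `exp(E(vᵢ)·z)`: `E(vᵢ)^j / j!`. [cite: Yu1990, §1.1] -/
def g3eC (i : ι) (j : ℕ) : ℚ_[p] := S.E (v i) ^ j / (j ! : ℚ_[p])

/-- The coefficients of the `Y₀`-weight polynomial `Hasse_{t₀} Rᵢ` (in `ℚ_p`). [cite: Nesterenko2003, §3.5 (3.34)] -/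
def g3wC (i : ι) (t₀ k : ℕ) : ℚ_[p] := (hw (p := p) R i t₀).coeff k

/-- The degree bound used to truncate. [folklore] -/
def g3wDeg (i : ι) (t₀ : ℕ) : ℕ := (hw (p := p) R i t₀).natDegree

/-- **The coefficient sequence of `f_τ`**: `coeffG3F n = Σ_i pᵢ · zγpow · Σ_{k ≤ deg, k ≤ n} g3wC k · g3eC (n − k)`.
[cite: Yu1990, Lemma 2.2] -/
def coeffG3F (B : Finset ι) (pv : ι → ℤ) (τ : Tau S.n) (n : ℕ) : ℚ_[p] :=
  ∑ i ∈ B, (pv i : ℚ_[p]) * (S.zγpow v i τ.2 : ℚ_[p]) *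
    ∑ k ∈ range (g3wDeg (p := p) R i τ.1 + 1), if k ≤ n then g3wC (p := p) R i τ.1 k * S.g3eC v i (n - k) else 0

/-! ### Convergence to `f_τ` on the big disc -/

/-- `exp(E(vᵢ)·z) = Σⱼ g3eC j zʲ` for `‖z‖ < p^m √p` and a depth-`m+1` exponent. [cite: Yu1990, §1.1] -/
theorem hasSum_g3eC (m : ℕ) (i : ι) (hi : ‖S.E (v i)‖ ≤ (p : ℝ)⁻¹ ^ (m + 1)) {z : ℚ_[p]}
    (hz : ‖z‖ < (p : ℝ) ^ m * Real.sqrt p) :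
    HasSum (fun j => S.g3eC v i j * z ^ j) (exp (S.E (v i) * z)) := by
  have hmem := S.mem_eball_of_norm_mul_lt (S.norm_mul_lt_of_depth m hi hz)
  rw [smul_eq_mul, mul_comm] at hmem
  have h := expSeries_hasSum_exp_of_mem_ball' (𝕂 := ℚ_[p]) (S.E (v i) * z) hmem
  refine h.congr_fun fun j => ?_
  rw [inv_natCast_smul_eq ℚ_[p] ℚ_[p], smul_eq_mul, g3eC, mul_pow]
  field_simp

/-- `(hw i t₀)(z) = Σ_{k ≤ deg} g3wC k zᵏ`. [folklore] -/
theorem hw_eval_eq_sum (i : ι) (t₀ : ℕ) (z : ℚ_[p]) :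
    (hw (p := p) R i t₀).eval z = ∑ k ∈ range (g3wDeg (p := p) R i t₀ + 1), g3wC (p := p) R i t₀ k * z ^ k := by
  unfold g3wDeg g3wC
  rw [Polynomial.eval_eq_sum_range]

/-- One shifted series: `Σₙ [k ≤ n] g3wC k · g3eC (n−k) zⁿ = g3wC k zᵏ · exp(E z)`. [cite: Yu1990, Lemma 2.2] -/
theorem hasSum_g3shift (m : ℕ) (i : ι) (hi : ‖S.E (v i)‖ ≤ (p : ℝ)⁻¹ ^ (m + 1)) (t₀ k : ℕ) {z : ℚ_[p]}
    (hz : ‖z‖ < (p : ℝ) ^ m * Real.sqrt p) :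
    HasSum (fun n => (if k ≤ n then g3wC (p := p) R i t₀ k * S.g3eC v i (n - k) else 0) * z ^ n)
      (g3wC (p := p) R i t₀ k * z ^ k * exp (S.E (v i) * z)) := by
  have h := (S.hasSum_g3eC v m i hi hz).mul_left (g3wC (p := p) R i t₀ k * z ^ k)
  rw [← hasSum_nat_add_iff' k]
  have h0 : ∑ n ∈ range k, (if k ≤ n then g3wC (p := p) R i t₀ k * S.g3eC v i (n - k) else 0) * z ^ n = 0 :=
    sum_eq_zero fun n hn => by rw [if_neg (by have := mem_range.mp hn; omega), zero_mul]
  rw [h0, sub_zero]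
  refine h.congr_fun fun n => ?_
  rw [if_pos (by omega), Nat.add_sub_cancel, pow_add]
  ring

/-- One term: `Σₙ (Σₖ [k ≤ n] g3wC k g3eC (n−k)) zⁿ = (hw i t₀)(z) · exp(E z)`. [cite: Yu1990, Lemma 2.2] -/
theorem hasSum_g3term (m : ℕ) (i : ι) (hi : ‖S.E (v i)‖ ≤ (p : ℝ)⁻¹ ^ (m + 1)) (τ : Tau S.n) {z : ℚ_[p]}
    (hz : ‖z‖ < (p : ℝ) ^ m * Real.sqrt p) :
    HasSum (fun n => (∑ k ∈ range (g3wDeg (p := p) R i τ.1 + 1),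
        (if k ≤ n then g3wC (p := p) R i τ.1 k * S.g3eC v i (n - k) else 0)) * z ^ n)
      ((hw (p := p) R i τ.1).eval z * exp (S.E (v i) * z)) := by
  have h := hasSum_sum fun k (_ : k ∈ range (g3wDeg (p := p) R i τ.1 + 1)) => S.hasSum_g3shift R v m i hi τ.1 k hz
  rw [hw_eval_eq_sum, sum_mul]
  refine h.congr_fun fun n => ?_
  rw [sum_mul]

/-- **`f_τ(z) = Σₙ coeffG3F n zⁿ` on the big disc.** [cite: Yu1990, Lemma 2.2] -/
theorem hasSum_coeffG3F (m : ℕ) (B : Finset ι) (hB : ∀ i ∈ B, ‖S.E (v i)‖ ≤ (p : ℝ)⁻¹ ^ (m + 1)) (pv : ι → ℤ)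
    (τ : Tau S.n) {z : ℚ_[p]} (hz : ‖z‖ < (p : ℝ) ^ m * Real.sqrt p) :
    HasSum (fun n => S.coeffG3F R v B pv τ n * z ^ n) (S.g3F R v B pv τ z) := by
  unfold g3F coeffG3F
  have h := hasSum_sum fun i (hi : i ∈ B) =>
    (S.hasSum_g3term R v m i (hB i hi) τ hz).mul_left ((pv i : ℚ_[p]) * (S.zγpow v i τ.2 : ℚ_[p]))
  have e : ∑ i ∈ B, (pv i : ℚ_[p]) * (S.zγpow v i τ.2 : ℚ_[p]) *
      ((hw (p := p) R i τ.1).eval z * exp (S.E (v i) * z)) =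
      ∑ i ∈ B, (pv i : ℚ_[p]) * S.g3termF R v i τ z :=
    sum_congr rfl fun i _ => by simp only [g3termF]; ring
  rw [← e]
  refine h.congr_fun fun n => ?_
  rw [sum_mul]
  exact sum_congr rfl fun i _ => by ring

/-- `f_τ(z) = Σ' coeffG3F n zⁿ` on the big disc. [cite: Yu1990, Lemma 2.2] -/
theorem g3F_eq_tsum (m : ℕ) (B : Finset ι) (hB : ∀ i ∈ B, ‖S.E (v i)‖ ≤ (p : ℝ)⁻¹ ^ (m + 1)) (pv : ι → ℤ)
    (τ : Tau S.n) {z : ℚ_[p]} (hz : ‖z‖ < (p : ℝ) ^ m * Real.sqrt p) :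
    S.g3F R v B pv τ z = ∑' n, S.coeffG3F R v B pv τ n * z ^ n :=
  (S.hasSum_coeffG3F R v m B hB pv τ hz).tsum_eq.symm

/-- `f_τ` agrees with its power series near every point of the big disc. [cite: Yu1990, Lemma 2.2] -/
theorem g3F_eventuallyEq_tsum (m : ℕ) (B : Finset ι) (hB : ∀ i ∈ B, ‖S.E (v i)‖ ≤ (p : ℝ)⁻¹ ^ (m + 1)) (pv : ι → ℤ)
    (τ : Tau S.n) {a : ℚ_[p]} (ha : ‖a‖ < (p : ℝ) ^ m * Real.sqrt p) :
    S.g3F R v B pv τ =ᶠ[𝓝 a] fun z => ∑' n, S.coeffG3F R v B pv τ n * z ^ n := by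
  have hball : {z : ℚ_[p] | ‖z‖ < (p : ℝ) ^ m * Real.sqrt p} ∈ 𝓝 a := by
    have : {z : ℚ_[p] | ‖z‖ < (p : ℝ) ^ m * Real.sqrt p} = Metric.ball 0 ((p : ℝ) ^ m * Real.sqrt p) := by
      ext z; simp
    rw [this]
    exact Metric.isOpen_ball.mem_nhds (by simpa using ha)
  filter_upwards [hball] with z hz using S.g3F_eq_tsum R v m B hB pv τ hz

/-! ### The weighted bound at the big radius -/

/-- `‖g3eC j‖·(p^m√p)ʲ ≤ 1` for a depth-`m+1` exponent. [cite: Yu1999, §10 (10.15)] -/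
theorem norm_g3eC_mul_le (m : ℕ) (i : ι) (hi : ‖S.E (v i)‖ ≤ (p : ℝ)⁻¹ ^ (m + 1)) (j : ℕ) :
    ‖S.g3eC v i j‖ * ((p : ℝ) ^ m * Real.sqrt p) ^ j ≤ 1 :=
  S.norm_pow_div_factorial_mul_le_depth m hi j

/-- **The weighted coefficient bound** `WtBdd (p^m√p) Bw coeffG3F` from the frame's bound on the `Y₀`-weights
`‖coeffₖ(hw i t₀)‖·(p^m√p)ᵏ ≤ Bw` (ultrametric: `pᵢ ∈ ℤ`, `‖zγpow‖ ≤ 1`, `‖g3eC j‖ρʲ ≤ 1`). [cite: Yu1990, Lemma 2.2] -/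
theorem wtBdd_coeffG3F (m : ℕ) (B : Finset ι) (hB : ∀ i ∈ B, ‖S.E (v i)‖ ≤ (p : ℝ)⁻¹ ^ (m + 1)) (pv : ι → ℤ)
    (τ : Tau S.n) {Bw : ℝ} (hBw0 : 0 ≤ Bw)
    (hBw : ∀ i ∈ B, ∀ k, ‖(hw (p := p) R i τ.1).coeff k‖ * ((p : ℝ) ^ m * Real.sqrt p) ^ k ≤ Bw) :
    PadicNewton.WtBdd ((p : ℝ) ^ m * Real.sqrt p) Bw (S.coeffG3F R v B pv τ) := by
  set ρ : ℝ := (p : ℝ) ^ m * Real.sqrt p with hρ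
  have hρ0 : 0 < ρ := by rw [hρ]; exact mul_pos (pow_pos S.p_pos m) S.sqrt_p_pos
  intro n
  have hsp : (0 : ℝ) < ρ ^ n := pow_pos hρ0 n
  rw [← le_div_iff₀ hsp]
  have hB' : 0 ≤ Bw / ρ ^ n := by positivity
  unfold coeffG3F
  refine norm_sum_le_of_forall_le_of_nonneg hB' fun i hi => ?_
  rw [norm_mul, norm_mul]
  refine (mul_le_of_le_one_left (norm_nonneg _)
    (mul_le_one₀ (Padic.norm_int_le_one _) (norm_nonneg _) (S.norm_zγpow_le v i τ.2))).trans ?_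
  refine norm_sum_le_of_forall_le_of_nonneg hB' fun k _ => ?_
  split_ifs with hkn
  · rw [le_div_iff₀ hsp, norm_mul]
    have e : ρ ^ n = ρ ^ k * ρ ^ (n - k) := by rw [← pow_add, Nat.add_sub_cancel' hkn]
    rw [e]
    calc ‖g3wC (p := p) R i τ.1 k‖ * ‖S.g3eC v i (n - k)‖ * (ρ ^ k * ρ ^ (n - k))
        = (‖g3wC (p := p) R i τ.1 k‖ * ρ ^ k) * (‖S.g3eC v i (n - k)‖ * ρ ^ (n - k)) := by ring
      _ ≤ Bw * 1 := mul_le_mul (hBw i hi k) (S.norm_g3eC_mul_le v m i (hB i hi) (n - k)) (by positivity) hBw0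
      _ = Bw := mul_one _
  · rw [norm_zero]; exact hB'

/-! ### Jets of `f_τ` from the values of the family -/

/-- **The jets of `f_τ` at a node are controlled by the values of the family there**: if `‖f_τ'(a)‖ ≤ ε` for all `|τ'| ≤ N`
at a point `‖a‖ ≤ 1`, then for `|τ| + k ≤ N` the `k`-th jet of the power series of `f_τ` at `a` has norm `≤ ‖(k!)⁻¹‖·ε`.
[cite: Yu1990, Lemma 2.4] -/
theorem norm_jet_g3F_le (m : ℕ) (B : Finset ι) (hB : ∀ i ∈ B, ‖S.E (v i)‖ ≤ (p : ℝ)⁻¹ ^ (m + 1)) (pv : ι → ℤ)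
    {Bw : ℝ} (hBw0 : 0 ≤ Bw) {a : ℚ_[p]} (ha : ‖a‖ ≤ 1) (N : ℕ) {ε : ℝ} (hε0 : 0 ≤ ε)
    (hε : ∀ τ : Tau S.n, tauNorm τ ≤ N → ‖S.g3F R v B pv τ a‖ ≤ ε)
    (k : ℕ) (τ : Tau S.n) (hBw : ∀ i ∈ B, ∀ k', ‖(hw (p := p) R i τ.1).coeff k'‖ * ((p : ℝ) ^ m * Real.sqrt p) ^ k' ≤ Bw)
    (hk : tauNorm τ + k ≤ N) :
    ‖PadicNewton.jet a (S.coeffG3F R v B pv τ) k‖ ≤ ‖((k ! : ℕ) : ℚ_[p])⁻¹‖ * ε := by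
  have h1ρ : (1 : ℝ) < (p : ℝ) ^ m * Real.sqrt p := by
    have hs : 1 < Real.sqrt p := by
      rw [show (1 : ℝ) = Real.sqrt 1 by simp]
      exact Real.sqrt_lt_sqrt zero_le_one S.one_lt_p
    calc (1 : ℝ) = 1 * 1 := (mul_one 1).symm
      _ < (p : ℝ) ^ m * Real.sqrt p := mul_lt_mul' (one_le_pow₀ S.one_lt_p.le) hs zero_le_one (pow_pos S.p_pos m)
  have ha' : ‖a‖ < (p : ℝ) ^ m * Real.sqrt p := lt_of_le_of_lt ha h1ρ
  have hb := S.wtBdd_coeffG3F R v m B hB pv τ hBw0 hBw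
  have hj := PadicNewton.norm_jet_le_norm_iteratedDeriv (mul_pos (pow_pos S.p_pos m) S.sqrt_p_pos) h1ρ one_pos hb ha k
  refine hj.trans (mul_le_mul_of_nonneg_left ?_ (norm_nonneg _))
  rw [← (S.g3F_eventuallyEq_tsum R v m B hB pv τ ha').iteratedDeriv_eq k]
  exact S.norm_iteratedDeriv_g3F_le_of_forall R v m B hB pv ha' N hε0 hε k τ hk

end G3Setup

end Summit.ABC.StewartYu

end
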